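import Summits.NavierStokesRegularity.NavierStokesRegularity.Theses.HardyPointSink
import Summits.NavierStokesRegularity.NavierStokesRegularity.Theorems.HardyPointSinkHardyEnergyBoundLedger
import Summits.NavierStokesRegularity.NavierStokesRegularity.Theorems.HardyPointSinkHardyEnergyBoundLocalHardyIdentity
import Summits.NavierStokesRegularity.NavierStokesRegularity.Theorems.HardyPointSinkHardyEnergyBoundSolenoidalHardyFlux
import Summits.NavierStokesRegularity.NavierStokesRegularity.Theorems.HardyPointSinkHardyEnergyBoundSpaceTimeL3
import Summits.NavierStokesRegularity.NavierStokesRegularity.Theorems.HardyPointSinkHardyEnergyBoundConverse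
import Literature.Analysis.FluidPDE.MildL3SmoothHolds
import HarnessLib

/-!
# Route HardyPointSink — `HardyEnergyBound`, line `birth`: the crux is EQUIVALENT to influx absorption

Item stmt-NavierStokesRegularity-7979 (crux `Theses.HardyPointSink.HardyEnergyBound`), registered anchor
`hardyEnergyBound_iff_influxAbsorption` (lead `prover-line-stmt-NavierStokesRegularity-7979-c1-0`).

The line `birth` cuts the crux along the point-sink LEDGER of the local Hardy energy of the classical
representative `(v, p)` of a Kato solution (`mild_L3_smooth_holds`): with
`H = ∫_{B(xs,R/4)} |v(t)|²/|x−x₀|`, `D = ∫_{T−R²}^t (2ν∫_{B(xs,R/2)} |∇v|²_F/|x−x₀| + 4πν|v(s,x₀)|²) ds`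
and the signed cumulative head flux through the sharp ball with the Riesz pressure
`I = ∫_{T−R²}^t ∫_{B(xs,R)} (|v|²/2 + Π[v s]) ⟨v, x−x₀⟩/|x−x₀|³`, the tree proves the ledger
`H + D ≤ C + ofReal(−2I)` up to the final time (`stub_hardyLedger_of` from `stub_localHardyIdentity`,
`stub_solenoidalHardyFlux`, `stub_spaceTimeL3`). This file records the two consequences:

* `hardyEnergyBound_of_influxAbsorption` — the HEART (influx absorption
  `ofReal(−2I) ≤ D + M` near every centre) implies the crux: the registered skeleton
  `Cruxes/HardyEnergyBound/Lines/birth.lean` with its only open stub as the hypothesis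
  (`r₀ = R/4`, `K = C + M`; the dissipation is finite by the ledger and cancels);
* `hardyEnergyBound_iff_influxAbsorption` — together with the converse
  (`hardyEnergyBound_influxAbsorption_of_crux`, `…Converse.lean`) the crux is EQUIVALENT to the
  heart: the line isolates no proper sub-content of the crux, which is therefore to be re-lined at the
  level of the absorption inequality (lead's HEART.md in the crux workfiles).
-/

noncomputable section

open Set MeasureTheory Filter Topology
open scoped ENNReal NNReal

set_option linter.dupNamespace false -- nested layout Summit.<S>.<Sub>, Sub = S (D-0017)

namespace Summit.NavierStokesRegularity.NavierStokesRegularity.Theorems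

/-- ENNReal bookkeeping: a ledger `H + D ≤ C + X` with finite source `X` and an absorption bound
`X ≤ D + M` give `H ≤ C + M` (the dissipation `D` is finite by the ledger and cancels). -/
theorem hardyEnergyBound_hardy_le_of_ledger_of_absorption {H D X : ℝ≥0∞} {C M : ℝ≥0} (hX : X ≠ ∞)
    (h1 : H + D ≤ C + X) (h2 : X ≤ D + M) : H ≤ ((C + M : ℝ≥0) : ℝ≥0∞) := by
  have hD : D ≠ ∞ := by
    refine ne_top_of_le_ne_top ?_ (le_trans le_add_self h1)
    exact ENNReal.add_ne_top.2 ⟨ENNReal.coe_ne_top, hX⟩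
  have h3 : H + D ≤ (C + M : ℝ≥0∞) + D := by
    calc H + D ≤ C + X := h1
      _ ≤ C + (D + M) := by gcongr
      _ = (C + M : ℝ≥0∞) + D := by ring
  have h4 : H ≤ (C : ℝ≥0∞) + M := (ENNReal.add_le_add_iff_right hD).1 h3
  simpa [ENNReal.coe_add] using h4

/-- **HEART ⇒ CRUX** (the registered skeleton of line `birth`, with its single open stub
`stub_influxAbsorption` as the hypothesis). If near every centre the cumulative head influx toward
any sink is paid for by the localised Hardy dissipation plus the point sink up to a bounded remainder,
then the local Hardy energy of every Kato solution from a Clay datum is bounded up to the final time: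
classical representative from `mild_L3_smooth_holds`; scale `R` and remainder `M` from the
hypothesis; constant `C` from the ledger `stub_hardyLedger_of`; answer `r₀ = R/4`, `K = C + M`. -/
theorem hardyEnergyBound_of_influxAbsorption
    (h3 : ∀ ν : ℝ, 0 < ν → ∀ u₀ : EuclideanSpace ℝ (Fin 3) → EuclideanSpace ℝ (Fin 3),
      ContDiff ℝ (⊤ : ℕ∞) u₀ → Literature.Analysis.FluidPDE.NSWave0.IsDivFree u₀ →
      Literature.Analysis.FluidPDE.HasRapidSpatialDecay u₀ →
      ∀ (T : ℝ) (u : ℝ → EuclideanSpace ℝ (Fin 3) → EuclideanSpace ℝ (Fin 3)), 0 < T →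
      Literature.Analysis.FluidPDE.IsKatoSolutionOn T ν u₀ u →
      ∀ (v : ℝ → EuclideanSpace ℝ (Fin 3) → EuclideanSpace ℝ (Fin 3))
        (p : ℝ → EuclideanSpace ℝ (Fin 3) → ℝ),
      Literature.Analysis.FluidPDE.IsClassicalNSSolutionOn (Set.Ioo 0 T) ν 0 v p →
      (∀ t ∈ Set.Ioo 0 T, v t =ᵐ[MeasureTheory.volume] u t) →
      ∀ xs : EuclideanSpace ℝ (Fin 3), ∃ R : ℝ, 0 < R ∧ R ^ 2 < T ∧
      ∃ M : NNReal, ∀ x₀ ∈ Metric.ball xs (R / 4), ∀ t ∈ Set.Ico (T - R ^ 2) T,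
        ENNReal.ofReal (-2 * ∫ s in (T - R ^ 2)..t, ∫ x in Metric.ball xs R,
              (‖v s x‖ ^ 2 / 2 + Literature.Analysis.FluidPDE.rieszPressure (v s) x)
                * inner ℝ (v s x) (x - x₀) / ‖x - x₀‖ ^ 3)
        ≤ (∫⁻ s in Set.Ioo (T - R ^ 2) t,
              (ENNReal.ofReal (2 * ν)
                  * (∫⁻ x in Metric.ball xs (R / 2),
                      ENNReal.ofReal (Literature.Analysis.FluidPDE.frobeniusNormSq (fderiv ℝ (v s) x))
                        / ‖x - x₀‖ₑ)
                + ENNReal.ofReal (4 * Real.pi * ν) * ‖v s x₀‖ₑ ^ 2))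
          + (M : ENNReal)) :
    Summit.NavierStokesRegularity.NavierStokesRegularity.Theses.HardyPointSink.HardyEnergyBound := by
  have h1 : Literature.Analysis.FluidPDE.mild_L3_smooth :=
    Literature.Analysis.FluidPDE.mild_L3_smooth_holds
  have h2 : ∀ ν : ℝ, 0 < ν → ∀ u₀ : EuclideanSpace ℝ (Fin 3) → EuclideanSpace ℝ (Fin 3),
      ContDiff ℝ (⊤ : ℕ∞) u₀ → Literature.Analysis.FluidPDE.NSWave0.IsDivFree u₀ →
      Literature.Analysis.FluidPDE.HasRapidSpatialDecay u₀ →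
      ∀ (T : ℝ) (u : ℝ → EuclideanSpace ℝ (Fin 3) → EuclideanSpace ℝ (Fin 3)), 0 < T →
      Literature.Analysis.FluidPDE.IsKatoSolutionOn T ν u₀ u →
      ∀ (v : ℝ → EuclideanSpace ℝ (Fin 3) → EuclideanSpace ℝ (Fin 3))
        (p : ℝ → EuclideanSpace ℝ (Fin 3) → ℝ),
      Literature.Analysis.FluidPDE.IsClassicalNSSolutionOn (Set.Ioo 0 T) ν 0 v p →
      (∀ t ∈ Set.Ioo 0 T, v t =ᵐ[MeasureTheory.volume] u t) →
      ∀ (xs : EuclideanSpace ℝ (Fin 3)) (R : ℝ), 0 < R → R ^ 2 < T →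
      ∃ C : NNReal, ∀ x₀ ∈ Metric.ball xs (R / 4), ∀ t ∈ Set.Ico (T - R ^ 2) T,
        (∫⁻ x in Metric.ball xs (R / 4), ‖v t x‖ₑ ^ 2 / ‖x - x₀‖ₑ)
          + (∫⁻ s in Set.Ioo (T - R ^ 2) t,
              (ENNReal.ofReal (2 * ν)
                  * (∫⁻ x in Metric.ball xs (R / 2),
                      ENNReal.ofReal (Literature.Analysis.FluidPDE.frobeniusNormSq (fderiv ℝ (v s) x))
                        / ‖x - x₀‖ₑ)
                + ENNReal.ofReal (4 * Real.pi * ν) * ‖v s x₀‖ₑ ^ 2))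
        ≤ (C : ENNReal)
          + ENNReal.ofReal (-2 * ∫ s in (T - R ^ 2)..t, ∫ x in Metric.ball xs R,
              (‖v s x‖ ^ 2 / 2 + Literature.Analysis.FluidPDE.rieszPressure (v s) x)
                * inner ℝ (v s x) (x - x₀) / ‖x - x₀‖ ^ 3) :=
    stub_hardyLedger_of stub_localHardyIdentity stub_solenoidalHardyFlux stub_spaceTimeL3
  intro ν hν u₀ hsm hdiv hdec T u hT hu xs
  -- the classical representative of the Kato solution on the open strip `(0, T)`
  obtain ⟨v, p, hcl, hae⟩ := h1 hν hT (hu.memLp_initial hT) (hu.isWeaklyDivFree_initial hT) hu.mild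
    hu.continuousInLpOn hu.aestronglyMeasurable
  -- absorption: the scale `R` and the remainder `M` at the centre `xs`
  obtain ⟨R, hR, hRT, M, hM⟩ := h3 ν hν u₀ hsm hdiv hdec T u hT hu v p hcl hae xs
  -- the ledger at that scale
  obtain ⟨C, hC⟩ := h2 ν hν u₀ hsm hdiv hdec T u hT hu v p hcl hae xs R hR hRT
  refine ⟨R / 4, by positivity, C + M, ?_⟩
  intro x₀ hx₀ t ht hlt
  -- the time window: `T - R² ≤ T - (R/4)² < t < T`, in particular `0 < t`
  have h16 : (R / 4) ^ 2 = R ^ 2 / 16 := by ring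
  have hsq : 0 ≤ R ^ 2 := sq_nonneg R
  have hR2t : T - R ^ 2 < t := by rw [h16] at hlt; linarith
  have ht' : t ∈ Set.Ico (T - R ^ 2) T := ⟨hR2t.le, ht.2⟩
  have htI : t ∈ Set.Ioo 0 T := ⟨by linarith, ht.2⟩
  -- the local Hardy energy of `u` at time `t` is that of its smooth representative `v`
  have hHv : (∫⁻ x in Metric.ball xs (R / 4), ‖u t x‖ₑ ^ 2 / ‖x - x₀‖ₑ)
      = ∫⁻ x in Metric.ball xs (R / 4), ‖v t x‖ₑ ^ 2 / ‖x - x₀‖ₑ := by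
    refine lintegral_congr_ae ?_
    filter_upwards [ae_restrict_of_ae (hae t htI)] with x hx
    rw [hx]
  rw [hHv]
  -- ledger + absorption + finiteness of the source term
  exact hardyEnergyBound_hardy_le_of_ledger_of_absorption ENNReal.ofReal_ne_top (hC x₀ hx₀ t ht')
    (hM x₀ hx₀ t ht')

/-- **CRUX ⟺ HEART.** `HardyEnergyBound` is equivalent to the influx-absorption inequality of line
`birth` (`hardyEnergyBound_influxAbsorption_of_crux` and `hardyEnergyBound_of_influxAbsorption`):
the point-sink ledger is an identity up to terms bounded up to the final time, so the heart carries
exactly the content of the crux. -/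
theorem hardyEnergyBound_iff_influxAbsorption :
    Summit.NavierStokesRegularity.NavierStokesRegularity.Theses.HardyPointSink.HardyEnergyBound ↔
    (∀ ν : ℝ, 0 < ν → ∀ u₀ : EuclideanSpace ℝ (Fin 3) → EuclideanSpace ℝ (Fin 3),
      ContDiff ℝ (⊤ : ℕ∞) u₀ → Literature.Analysis.FluidPDE.NSWave0.IsDivFree u₀ →
      Literature.Analysis.FluidPDE.HasRapidSpatialDecay u₀ →
      ∀ (T : ℝ) (u : ℝ → EuclideanSpace ℝ (Fin 3) → EuclideanSpace ℝ (Fin 3)), 0 < T →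
      Literature.Analysis.FluidPDE.IsKatoSolutionOn T ν u₀ u →
      ∀ (v : ℝ → EuclideanSpace ℝ (Fin 3) → EuclideanSpace ℝ (Fin 3))
        (p : ℝ → EuclideanSpace ℝ (Fin 3) → ℝ),
      Literature.Analysis.FluidPDE.IsClassicalNSSolutionOn (Set.Ioo 0 T) ν 0 v p →
      (∀ t ∈ Set.Ioo 0 T, v t =ᵐ[MeasureTheory.volume] u t) →
      ∀ xs : EuclideanSpace ℝ (Fin 3), ∃ R : ℝ, 0 < R ∧ R ^ 2 < T ∧
      ∃ M : NNReal, ∀ x₀ ∈ Metric.ball xs (R / 4), ∀ t ∈ Set.Ico (T - R ^ 2) T,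
        ENNReal.ofReal (-2 * ∫ s in (T - R ^ 2)..t, ∫ x in Metric.ball xs R,
              (‖v s x‖ ^ 2 / 2 + Literature.Analysis.FluidPDE.rieszPressure (v s) x)
                * inner ℝ (v s x) (x - x₀) / ‖x - x₀‖ ^ 3)
        ≤ (∫⁻ s in Set.Ioo (T - R ^ 2) t,
              (ENNReal.ofReal (2 * ν)
                  * (∫⁻ x in Metric.ball xs (R / 2),
                      ENNReal.ofReal (Literature.Analysis.FluidPDE.frobeniusNormSq (fderiv ℝ (v s) x))
                        / ‖x - x₀‖ₑ)
                + ENNReal.ofReal (4 * Real.pi * ν) * ‖v s x₀‖ₑ ^ 2))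
          + (M : ENNReal)) :=
  ⟨hardyEnergyBound_influxAbsorption_of_crux, hardyEnergyBound_of_influxAbsorption⟩

end Summit.NavierStokesRegularity.NavierStokesRegularity.Theorems
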